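import Mathlib
import Summits.MatrixMultiplication.MatrixMultiplication.Theorems.SoloBlindFlatWrapper

/-!
# Flat certificate, four letters, mode E — chunks 2, 3 of 23

`native_decide` evaluations of `soloBlindFlatCertCanon 4 23 i 56 true` (every admissible canonical
sub-family of `range 16` with family code `≡ i (mod 23)` is accepted by the checker in mode E at
scale `56`).  Assembled in `SoloBlindEFlatCorankFour`.  Computational.
-/

namespace Summit.MatrixMultiplication.MatrixMultiplication.Theorems

/-- Flat certificate, four letters, mode E, chunk `2` of `23`. -/
theorem soloBlind_flatCert_four_E_2 : soloBlindFlatCertCanon 4 23 2 56 true = true := by native_decide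

/-- Flat certificate, four letters, mode E, chunk `3` of `23`. -/
theorem soloBlind_flatCert_four_E_3 : soloBlindFlatCertCanon 4 23 3 56 true = true := by native_decide

end Summit.MatrixMultiplication.MatrixMultiplication.Theorems
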